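import Summits.ResolutionOfSingularities.ResolutionOfSingularities.Theorems.FrobeniusLadderFInjectiveMacaulayficationDiagonalBPCIPrime
import Mathlib.RingTheory.Polynomial.GaussLemma
import Mathlib.Algebra.MvPolynomial.Equiv
import Mathlib.RingTheory.MvPolynomial.Basic
import Mathlib.RingTheory.Polynomial.UniqueFactorization
import HarnessLib

/-!
# GENERIC MONIC-TOWER PRIMALITY: `(x₀² − G(x₂..x₅), x₁³ + H(x₂..x₅)) ⊂ k[x₀, …, x₅]` is prime whenever `−H` is not a cube and `G` is not a square in
# `k[x₂, …, x₅]`; and `x₀² − g` is a prime ELEMENT of `k[x₀, …, x₅]` whenever `g ∈ k[x₁, …, x₅]` is not a square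
# (crux `FInjectiveMacaulayfication` stmt-ResolutionOfSingularities-15315, chain w45a; res-L1-w45a-plan-1 RULING R23.11 (2)/(4): the point-blow-up charts of BED CI-1 are again
# monic towers, and further CI beds go «via the reusable tower lemmas»; seat res-L1-w45a-stub-2 g13)

[OURS · L1 W4.5a] Support file (`--supports stmt-ResolutionOfSingularities-15315 --as helper`); def-free; UNCONDITIONAL; no named fact, no sorry; NOT a statement of any
manuscript; replaces the role of NO printed item. Nothing of the crux is proved. AI-written (AI review weaker than expert review).

This is ✓ `DiagonalBPCIPrime` (A5b, the vertex presentation of BED CI-1) with the two specimen computations `no_cube` / `no_square` turned into HYPOTHESES, over an arbitrary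
integrally closed domain `D` for the field-theoretic part:
* §1 (`D` an integrally closed domain, `K₀ = Frac D`) `no_root_cubic`, `irreducible_cubic`, `isDomain_T₁` (`T₁ = D[X]/(X³ + H)` is a domain if `y³ + H ≠ 0` for all `y ∈ D`);
  `no_root_quadratic`, `irreducible_quadratic` (over the cubic field `L₁ = K₀[X]/(X³+H)`, by the norm argument ✓ `DiagonalBPCIPrime.sq_eq_of_sq_eq_algebraMap`),
  ★ `isDomain_T₂` (`T₂ = T₁[X]/(X² − G)` is a domain if moreover `y² ≠ G` for all `y ∈ D`); ★ `prime_X_sq_sub_C` (`X² − g ∈ D[X]` is a prime element if `g` is not a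
  square in `D`, `D` a UFD: Gauss).
* §2 ★ `prime_X0_sq_sub_rename` — transport to six variables: `x₀² − g(x₁, …, x₅)` is a PRIME ELEMENT of `k[x₀, …, x₅]` for `g ∈ k[x₁..x₅]` not a square
  (`MvPolynomial.finSuccEquiv`); `not_dvd_of_eval` (a point where `a = 0 ≠ b` shows `a ∤ b`).
* §3 ★★ `isPrime_span_tower` — for `G, H ∈ C = k[x₂, …, x₅]` (embedded by `ι : X m ↦ X (m+2)`) with `−H` not a cube and `G` not a square in `C`: the ideal
  `(x₀² − ιG, x₁³ + ιH) ⊂ k[x₀, …, x₅]` is PRIME (the kernel of `Φ : k[x] → T₂`, left inverse by the universal properties), and `x₂, …, x₅ ∉` it.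
[cite: Matsumura1987, Thm. 9.1] [folklore: Gauss's lemma; the norm argument]
-/

-- single-problem summit: the doubled namespace component is forced
set_option linter.dupNamespace false

noncomputable section

open Polynomial

namespace Summit.ResolutionOfSingularities.ResolutionOfSingularities.Theorems.FInjectiveMacaulayfication.MonicTowerPrime

open Summit.ResolutionOfSingularities.ResolutionOfSingularities.Theorems.FInjectiveMacaulayfication DiagonalBPCIPrime

/-! ## §1 The tower over an integrally closed domain -/

section Domain

variable (D : Type) [CommRing D] [IsDomain D] [IsIntegrallyClosed D]

omit [IsDomain D] in
/-- `X³ + H` has NO ROOT in `K₀ = Frac D` if `−H` is not a cube in `D`: a root is integral over the integrally closed `D`. [folklore] -/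
theorem no_root_cubic (H : D) (hH : ∀ y : D, y ^ 3 + H ≠ 0) (ρ : FractionRing D) : ρ ^ 3 + algebraMap D (FractionRing D) H ≠ 0 := by
  intro h0
  have hint : IsIntegral D ρ := by
    refine ⟨X ^ 3 + Polynomial.C H, Polynomial.monic_X_pow_add_C _ (by norm_num), ?_⟩
    simp only [Polynomial.eval₂_add, Polynomial.eval₂_X_pow, Polynomial.eval₂_C]
    exact h0
  obtain ⟨y, hy⟩ := IsIntegrallyClosed.algebraMap_eq_of_integral hint
  apply hH y
  apply IsFractionRing.injective D (FractionRing D)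
  rw [map_add, map_pow, hy, h0, map_zero]

omit [IsDomain D] in
/-- `X² − G` has NO ROOT in `K₀ = Frac D` if `G` is not a square in `D`. [folklore] -/
theorem no_root_quadratic (G : D) (hG : ∀ y : D, y ^ 2 ≠ G) (ρ : FractionRing D) : ρ ^ 2 ≠ algebraMap D (FractionRing D) G := by
  intro h0
  have hint : IsIntegral D ρ := by
    refine ⟨X ^ 2 - Polynomial.C G, Polynomial.monic_X_pow_sub_C _ (by norm_num), ?_⟩
    simp only [Polynomial.eval₂_sub, Polynomial.eval₂_X_pow, Polynomial.eval₂_C]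
    rw [h0, sub_self]
  obtain ⟨y, hy⟩ := IsIntegrallyClosed.algebraMap_eq_of_integral hint
  apply hG y
  apply IsFractionRing.injective D (FractionRing D)
  rw [map_pow, hy, h0]

/-- ★ **`X³ + H` IS IRREDUCIBLE OVER `K₀ = Frac D`** (cubic without a root). [folklore] -/
theorem irreducible_cubic (H : D) (hH : ∀ y : D, y ^ 3 + H ≠ 0) (f₁ : D[X]) (hf₁ : f₁ = X ^ 3 + Polynomial.C H) :
    Irreducible (f₁.map (algebraMap D (FractionRing D))) := by
  have hmap : f₁.map (algebraMap D (FractionRing D)) = X ^ 3 + Polynomial.C (algebraMap D (FractionRing D) H) := by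
    rw [hf₁, Polynomial.map_add, Polynomial.map_pow, Polynomial.map_X, Polynomial.map_C]
  rw [hmap]
  have hmonic : (X ^ 3 + Polynomial.C (algebraMap D (FractionRing D) H)).Monic := Polynomial.monic_X_pow_add_C _ (by norm_num)
  refine (hmonic.irreducible_iff_roots_eq_zero_of_degree_le_three (by rw [Polynomial.natDegree_X_pow_add_C]; norm_num)
    Polynomial.natDegree_X_pow_add_C.le).mpr (Multiset.eq_zero_iff_forall_notMem.mpr fun ρ hρ => ?_)
  rw [Polynomial.mem_roots hmonic.ne_zero, Polynomial.IsRoot.def, Polynomial.eval_add, Polynomial.eval_pow, Polynomial.eval_X, Polynomial.eval_C] at hρ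
  exact no_root_cubic D H hH ρ hρ

omit [IsIntegrallyClosed D] in
/-- `f₁ = X³ + H` is monic of degree `3`. [plumbing] -/
theorem monic_f₁ (H : D) (f₁ : D[X]) (hf₁ : f₁ = X ^ 3 + Polynomial.C H) : f₁.Monic ∧ f₁.natDegree = 3 := by
  rw [hf₁]
  exact ⟨Polynomial.monic_X_pow_add_C _ (by norm_num), Polynomial.natDegree_X_pow_add_C⟩

/-- ★ **`T₁ = D[X]/(X³ + H)` IS A DOMAIN** if `−H` is not a cube in `D`. [folklore] -/
theorem isDomain_T₁ (H : D) (hH : ∀ y : D, y ^ 3 + H ≠ 0) (f₁ : D[X]) (hf₁ : f₁ = X ^ 3 + Polynomial.C H) : IsDomain (AdjoinRoot f₁) :=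
  isDomain_adjoinRoot_of_irreducible_map _ (IsFractionRing.injective D (FractionRing D)) f₁ (monic_f₁ D H f₁ hf₁).1 (irreducible_cubic D H hH f₁ hf₁)

/-- ★ **`X² − G` IS IRREDUCIBLE OVER THE CUBIC FIELD `L₁ = K₀[X]/(X³ + H)`**: a root `σ` would make `G = (N(σ)/G)²` a square in `K₀` (`[L₁ : K₀] = 3`,
✓ `DiagonalBPCIPrime.sq_eq_of_sq_eq_algebraMap`), excluded by `no_root_quadratic`. [folklore: norm argument] -/
theorem irreducible_quadratic (G : D) (hG : ∀ y : D, y ^ 2 ≠ G) (H : D) (hH : ∀ y : D, y ^ 3 + H ≠ 0)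
    (f₁ : D[X]) (hf₁ : f₁ = X ^ 3 + Polynomial.C H) (f₂ : Polynomial (AdjoinRoot f₁)) (hf₂ : f₂ = X ^ 2 - Polynomial.C (AdjoinRoot.of f₁ G))
    (ρ₁ : AdjoinRoot f₁ →+* AdjoinRoot (f₁.map (algebraMap D (FractionRing D))))
    (hρ₁C : ∀ d, ρ₁ (AdjoinRoot.of f₁ d) = AdjoinRoot.of _ (algebraMap D (FractionRing D) d)) : Irreducible (f₂.map ρ₁) := by
  haveI : Fact (Irreducible (f₁.map (algebraMap D (FractionRing D)))) := ⟨irreducible_cubic D H hH f₁ hf₁⟩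
  set γ : FractionRing D := algebraMap D (FractionRing D) G with hγdef
  have hmap : f₂.map ρ₁ = X ^ 2 - Polynomial.C (algebraMap (FractionRing D) _ γ) := by
    rw [hf₂, Polynomial.map_sub, Polynomial.map_pow, Polynomial.map_X, Polynomial.map_C, hρ₁C, AdjoinRoot.algebraMap_eq]
  rw [hmap]
  have hmonic := Polynomial.monic_X_pow_sub_C (algebraMap (FractionRing D) (AdjoinRoot (f₁.map (algebraMap D (FractionRing D)))) γ) (two_ne_zero)
  refine (hmonic.irreducible_iff_roots_eq_zero_of_degree_le_three Polynomial.natDegree_X_pow_sub_C.ge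
    (by rw [Polynomial.natDegree_X_pow_sub_C]; norm_num)).mpr (Multiset.eq_zero_iff_forall_notMem.mpr fun σ hσ => ?_)
  rw [Polynomial.mem_roots hmonic.ne_zero, Polynomial.IsRoot.def, Polynomial.eval_sub, Polynomial.eval_pow, Polynomial.eval_X, Polynomial.eval_C,
    sub_eq_zero] at hσ
  have hfin : Module.finrank (FractionRing D) (AdjoinRoot (f₁.map (algebraMap D (FractionRing D)))) = 3 := by
    rw [(AdjoinRoot.powerBasis (Fact.out : Irreducible (f₁.map (algebraMap D (FractionRing D)))).ne_zero).finrank, AdjoinRoot.powerBasis_dim,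
      (monic_f₁ D H f₁ hf₁).1.natDegree_map, (monic_f₁ D H f₁ hf₁).2]
  have hG0 : G ≠ 0 := fun hG0 => hG 0 (by rw [hG0]; ring)
  have hγ : γ ≠ 0 := (map_ne_zero_iff _ (IsFractionRing.injective D (FractionRing D))).mpr hG0
  exact no_root_quadratic D G hG _ (sq_eq_of_sq_eq_algebraMap hfin γ hγ σ hσ)

/-- ★ **`T₂ = T₁[X]/(X² − G)` IS A DOMAIN** if `−H` is not a cube and `G` is not a square in `D`. [folklore] -/
theorem isDomain_T₂ (G : D) (hG : ∀ y : D, y ^ 2 ≠ G) (H : D) (hH : ∀ y : D, y ^ 3 + H ≠ 0)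
    (f₁ : D[X]) (hf₁ : f₁ = X ^ 3 + Polynomial.C H) (f₂ : Polynomial (AdjoinRoot f₁)) (hf₂ : f₂ = X ^ 2 - Polynomial.C (AdjoinRoot.of f₁ G)) :
    IsDomain (AdjoinRoot f₂) := by
  haveI : Fact (Irreducible (f₁.map (algebraMap D (FractionRing D)))) := ⟨irreducible_cubic D H hH f₁ hf₁⟩
  obtain ⟨ρ₁, hρ₁C, hρ₁X⟩ := exists_hom_of_monic (algebraMap D (FractionRing D)) f₁
  have hinj := injective_of_monic _ (IsFractionRing.injective D (FractionRing D)) f₁ (monic_f₁ D H f₁ hf₁).1 ρ₁ hρ₁C hρ₁X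
  have hmonic₂ : f₂.Monic := by rw [hf₂]; exact Polynomial.monic_X_pow_sub_C _ two_ne_zero
  exact isDomain_adjoinRoot_of_irreducible_map ρ₁ hinj f₂ hmonic₂ (irreducible_quadratic D G hG H hH f₁ hf₁ f₂ hf₂ ρ₁ hρ₁C)

/-- ★ **`X² − g ∈ D[X]` IS A PRIME ELEMENT if `g` is not a square in `D`** (`D` an integrally closed domain which is a UFD): irreducible over `Frac D` (quadratic
without a root), hence irreducible over `D` (Gauss's lemma for monic polynomials), hence prime (`D[X]` is a UFD). [folklore: Gauss] -/
theorem prime_X_sq_sub_C [UniqueFactorizationMonoid D] (g : D) (hg : ∀ y : D, y ^ 2 ≠ g) : Prime (X ^ 2 - Polynomial.C g : D[X]) := by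
  have hmonic : (X ^ 2 - Polynomial.C g : D[X]).Monic := Polynomial.monic_X_pow_sub_C _ two_ne_zero
  have hirr : Irreducible ((X ^ 2 - Polynomial.C g : D[X]).map (algebraMap D (FractionRing D))) := by
    have hmap : (X ^ 2 - Polynomial.C g : D[X]).map (algebraMap D (FractionRing D)) = X ^ 2 - Polynomial.C (algebraMap D (FractionRing D) g) := by
      rw [Polynomial.map_sub, Polynomial.map_pow, Polynomial.map_X, Polynomial.map_C]
    rw [hmap]
    have hmonic' := Polynomial.monic_X_pow_sub_C (algebraMap D (FractionRing D) g) two_ne_zero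
    refine (hmonic'.irreducible_iff_roots_eq_zero_of_degree_le_three Polynomial.natDegree_X_pow_sub_C.ge
      (by rw [Polynomial.natDegree_X_pow_sub_C]; norm_num)).mpr (Multiset.eq_zero_iff_forall_notMem.mpr fun σ hσ => ?_)
    rw [Polynomial.mem_roots hmonic'.ne_zero, Polynomial.IsRoot.def, Polynomial.eval_sub, Polynomial.eval_pow, Polynomial.eval_X, Polynomial.eval_C,
      sub_eq_zero] at hσ
    exact no_root_quadratic D g hg σ hσ
  exact ((hmonic.irreducible_iff_irreducible_map_fraction_map (K := FractionRing D)).mpr hirr).prime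

end Domain

/-! ## §2 Six variables: `x₀² − g(x₁..x₅)` is a prime element; non-divisibility by evaluation -/

variable (k : Type) [Field k]

/-- `finSuccEquiv` sends a polynomial in the LAST five variables to a constant: `finSuccEquiv (rename succ g) = C g`. [plumbing] -/
theorem finSuccEquiv_rename_succ (g : MvPolynomial (Fin 5) k) :
    MvPolynomial.finSuccEquiv k 5 (MvPolynomial.rename Fin.succ g) = Polynomial.C g := by
  induction g using MvPolynomial.induction_on with
  | C a =>
    rw [MvPolynomial.rename_C, MvPolynomial.finSuccEquiv_apply, MvPolynomial.eval₂Hom_C, RingHom.comp_apply]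
  | add p q hp hq => rw [map_add, map_add, hp, hq, Polynomial.C_add]
  | mul_X p j hp => rw [map_mul, MvPolynomial.rename_X, map_mul, hp, MvPolynomial.finSuccEquiv_X_succ, ← Polynomial.C_mul]

/-- ★ **`x₀² − g(x₁, …, x₅)` IS A PRIME ELEMENT of `k[x₀, …, x₅]`** when `g ∈ k[x₁..x₅]` (embedded by `rename Fin.succ`) is not a square in `k[x₁..x₅]`: transport of
`prime_X_sq_sub_C` along `k[x₀..x₅] ≅ k[x₁..x₅][X]` (`MvPolynomial.finSuccEquiv`). [folklore] -/
theorem prime_X0_sq_sub_rename (g : MvPolynomial (Fin 5) k) (hg : ∀ y : MvPolynomial (Fin 5) k, y ^ 2 ≠ g) :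
    Prime ((MvPolynomial.X 0 : MvPolynomial (Fin 6) k) ^ 2 - MvPolynomial.rename Fin.succ g) := by
  have hp : Prime (X ^ 2 - Polynomial.C g : (MvPolynomial (Fin 5) k)[X]) := prime_X_sq_sub_C (MvPolynomial (Fin 5) k) g hg
  have he : MvPolynomial.finSuccEquiv k 5 ((MvPolynomial.X 0 : MvPolynomial (Fin 6) k) ^ 2 - MvPolynomial.rename Fin.succ g) =
      X ^ 2 - Polynomial.C g := by
    rw [map_sub, map_pow, MvPolynomial.finSuccEquiv_X_zero, finSuccEquiv_rename_succ]
  refine (MulEquiv.prime_iff (MvPolynomial.finSuccEquiv k 5)).mp ?_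
  rw [he]
  exact hp

/-- **Non-divisibility by evaluation**: if some point `c ∈ k⁶` has `a(c) = 0` and `b(c) ≠ 0`, then `a ∤ b`. [elementary] -/
theorem not_dvd_of_eval {n : ℕ} (a b : MvPolynomial (Fin n) k) (c : Fin n → k) (ha : MvPolynomial.eval c a = 0) (hb : MvPolynomial.eval c b ≠ 0) : ¬ a ∣ b := by
  rintro ⟨d, rfl⟩
  exact hb (by rw [map_mul, ha, zero_mul])

/-! ## §3 ★★ The tower ideal `(x₀² − ιG, x₁³ + ιH)` is prime -/

/-- ★★ **GENERIC MONIC-TOWER PRIMALITY.** For `G, H ∈ C = k[x₂, …, x₅]` (as `MvPolynomial (Fin 4) k`, embedded into `k[x₀, …, x₅]` by `ι : X m ↦ X (m+2)`) with `−H` not a cube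
and `G` not a square in `C`: the ideal `I = (x₀² − ιG, x₁³ + ιH) ⊂ k[x₀, …, x₅]` is PRIME, and `x₂, x₃, x₄, x₅ ∉ I`. Proof: `Φ : k[x] → T₂ = C[X̄₁][X̄₂]` (`x₀ ↦ X̄₂`,
`x₁ ↦ X̄₁`, `x_{m+2} ↦ x_m`) kills `I`; the universal properties of the two monic extensions give `Ψ : T₂ → k[x]/I` with `Ψ ∘ Φ = mk`, so `ker Φ = I`, prime since `T₂` is a
domain (`isDomain_T₂`); `Φ(x_{m+2}) = x_m ≠ 0` in `T₂` (`AdjoinRoot.of` is injective for monic polynomials of positive degree). [folklore] -/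
theorem isPrime_span_tower (G H : MvPolynomial (Fin 4) k) (hG : ∀ y : MvPolynomial (Fin 4) k, y ^ 2 ≠ G) (hH : ∀ y : MvPolynomial (Fin 4) k, y ^ 3 + H ≠ 0)
    (I : Ideal (MvPolynomial (Fin 6) k))
    (hI : I = Ideal.span {(MvPolynomial.X 0 : MvPolynomial (Fin 6) k) ^ 2 -
        MvPolynomial.eval₂Hom MvPolynomial.C ![MvPolynomial.X 2, MvPolynomial.X 3, MvPolynomial.X 4, MvPolynomial.X 5] G,
      (MvPolynomial.X 1 : MvPolynomial (Fin 6) k) ^ 3 +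
        MvPolynomial.eval₂Hom MvPolynomial.C ![MvPolynomial.X 2, MvPolynomial.X 3, MvPolynomial.X 4, MvPolynomial.X 5] H}) :
    I.IsPrime ∧ ∀ m : Fin 4, (![MvPolynomial.X 2, MvPolynomial.X 3, MvPolynomial.X 4, MvPolynomial.X 5] m : MvPolynomial (Fin 6) k) ∉ I := by
  set ι : MvPolynomial (Fin 4) k →+* MvPolynomial (Fin 6) k :=
    MvPolynomial.eval₂Hom MvPolynomial.C ![MvPolynomial.X 2, MvPolynomial.X 3, MvPolynomial.X 4, MvPolynomial.X 5] with hι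
  obtain ⟨f₁, hf₁⟩ : ∃ f₁ : Polynomial (MvPolynomial (Fin 4) k), f₁ = X ^ 3 + Polynomial.C H := ⟨_, rfl⟩
  obtain ⟨f₂, hf₂⟩ : ∃ f₂ : Polynomial (AdjoinRoot f₁), f₂ = X ^ 2 - Polynomial.C (AdjoinRoot.of f₁ G) := ⟨_, rfl⟩
  haveI hT₁ := isDomain_T₁ (MvPolynomial (Fin 4) k) H hH f₁ hf₁
  haveI := isDomain_T₂ (MvPolynomial (Fin 4) k) G hG H hH f₁ hf₁ f₂ hf₂
  -- `Φ : k[x] → T₂`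
  set Φ : MvPolynomial (Fin 6) k →+* AdjoinRoot f₂ := MvPolynomial.eval₂Hom ((AdjoinRoot.of f₂).comp ((AdjoinRoot.of f₁).comp MvPolynomial.C))
    ![AdjoinRoot.root f₂, AdjoinRoot.of f₂ (AdjoinRoot.root f₁), AdjoinRoot.of f₂ (AdjoinRoot.of f₁ (MvPolynomial.X 0)),
      AdjoinRoot.of f₂ (AdjoinRoot.of f₁ (MvPolynomial.X 1)), AdjoinRoot.of f₂ (AdjoinRoot.of f₁ (MvPolynomial.X 2)),
      AdjoinRoot.of f₂ (AdjoinRoot.of f₁ (MvPolynomial.X 3))] with hΦ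
  have hΦC : ∀ a : k, Φ (MvPolynomial.C a) = AdjoinRoot.of f₂ (AdjoinRoot.of f₁ (MvPolynomial.C a)) := fun a => by
    rw [hΦ, MvPolynomial.eval₂Hom_C, RingHom.comp_apply, RingHom.comp_apply]
  have hΦX : ∀ i : Fin 6, Φ (MvPolynomial.X i) = ![AdjoinRoot.root f₂, AdjoinRoot.of f₂ (AdjoinRoot.root f₁),
      AdjoinRoot.of f₂ (AdjoinRoot.of f₁ (MvPolynomial.X 0)), AdjoinRoot.of f₂ (AdjoinRoot.of f₁ (MvPolynomial.X 1)),
      AdjoinRoot.of f₂ (AdjoinRoot.of f₁ (MvPolynomial.X 2)), AdjoinRoot.of f₂ (AdjoinRoot.of f₁ (MvPolynomial.X 3))] i := fun i => by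
    rw [hΦ, MvPolynomial.eval₂Hom_X']
  -- `Φ ∘ ι = of ∘ of`
  have hΦι : Φ.comp ι = (AdjoinRoot.of f₂).comp (AdjoinRoot.of f₁) := by
    refine MvPolynomial.ringHom_ext (fun a => ?_) (fun m => ?_)
    · rw [RingHom.comp_apply, hι, MvPolynomial.eval₂Hom_C, hΦC, RingHom.comp_apply]
    · rw [RingHom.comp_apply, hι, MvPolynomial.eval₂Hom_X', RingHom.comp_apply]
      fin_cases m <;> simp [hΦX]
  -- `Φ` kills the two generators
  have hR₁ := congrArg (AdjoinRoot.of f₂) (root₁_rel k H f₁ hf₁)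
  rw [map_zero, map_add, map_pow] at hR₁
  have hR₂ := root₂_rel k G f₁ f₂ hf₂
  have hΦP : Φ ((MvPolynomial.X 0 : MvPolynomial (Fin 6) k) ^ 2 - ι G) = 0 := by
    rw [map_sub, map_pow, hΦX, show Φ (ι G) = (Φ.comp ι) G from rfl, hΦι]
    simp only [Matrix.cons_val_zero, RingHom.comp_apply]
    rw [hR₂, sub_self]
  have hΦQ : Φ ((MvPolynomial.X 1 : MvPolynomial (Fin 6) k) ^ 3 + ι H) = 0 := by
    rw [map_add, map_pow, hΦX, show Φ (ι H) = (Φ.comp ι) H from rfl, hΦι]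
    simp only [Matrix.cons_val_one, Matrix.cons_val_zero, RingHom.comp_apply]
    exact hR₁
  -- `ker Φ = I`
  have hker : RingHom.ker Φ = I := by
    -- the left inverse `Ψ : T₂ → k[x]/I`
    set ψ₀ : MvPolynomial (Fin 4) k →+* MvPolynomial (Fin 6) k ⧸ I := (Ideal.Quotient.mk I).comp ι with hψ₀
    have h₁ : f₁.eval₂ ψ₀ (Ideal.Quotient.mk I (MvPolynomial.X 1)) = 0 := by
      rw [hf₁, Polynomial.eval₂_add, Polynomial.eval₂_X_pow, Polynomial.eval₂_C, hψ₀, RingHom.comp_apply, ← map_pow, ← map_add,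
        Ideal.Quotient.eq_zero_iff_mem, hI]
      exact Ideal.subset_span (Or.inr rfl)
    set ψ₁ : AdjoinRoot f₁ →+* MvPolynomial (Fin 6) k ⧸ I := AdjoinRoot.lift ψ₀ (Ideal.Quotient.mk I (MvPolynomial.X 1)) h₁ with hψ₁
    have h₂ : f₂.eval₂ ψ₁ (Ideal.Quotient.mk I (MvPolynomial.X 0)) = 0 := by
      rw [hf₂, Polynomial.eval₂_sub, Polynomial.eval₂_X_pow, Polynomial.eval₂_C, hψ₁, AdjoinRoot.lift_of, hψ₀, RingHom.comp_apply, ← map_pow,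
        ← map_sub, Ideal.Quotient.eq_zero_iff_mem, hI]
      exact Ideal.subset_span (Or.inl rfl)
    set Ψ : AdjoinRoot f₂ →+* MvPolynomial (Fin 6) k ⧸ I := AdjoinRoot.lift ψ₁ (Ideal.Quotient.mk I (MvPolynomial.X 0)) h₂ with hΨ
    have hcomp : Ψ.comp Φ = Ideal.Quotient.mk I := by
      refine MvPolynomial.ringHom_ext (fun a => ?_) (fun i => ?_)
      · rw [RingHom.comp_apply, hΦC, hΨ, AdjoinRoot.lift_of, hψ₁, AdjoinRoot.lift_of, hψ₀, RingHom.comp_apply, hι, MvPolynomial.eval₂Hom_C]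
      · rw [RingHom.comp_apply, hΦX]
        fin_cases i
        · simp only [Fin.zero_eta, Matrix.cons_val_zero]
          rw [hΨ, AdjoinRoot.lift_root]
        · simp only [Fin.mk_one, Matrix.cons_val_one, Matrix.cons_val_zero]
          rw [hΨ, AdjoinRoot.lift_of, hψ₁, AdjoinRoot.lift_root]
        all_goals
          simp only [Fin.reduceFinMk, Matrix.cons_val]
          rw [hΨ, AdjoinRoot.lift_of, hψ₁, AdjoinRoot.lift_of, hψ₀, RingHom.comp_apply, hι, MvPolynomial.eval₂Hom_X']
          simp
    refine le_antisymm (fun g hg => ?_) ?_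
    · rw [RingHom.mem_ker] at hg
      rw [← Ideal.Quotient.eq_zero_iff_mem, ← hcomp, RingHom.comp_apply, hg, map_zero]
    · rw [hI, Ideal.span_le]
      rintro _ (rfl | rfl)
      · exact hΦP
      · exact hΦQ
  refine ⟨by rw [← hker]; exact RingHom.ker_isPrime Φ, fun m hm => ?_⟩
  -- `x_{m+2} ∉ I`: its image `x_m ∈ C ↪ T₁ ↪ T₂` is non-zero
  rw [← hker, RingHom.mem_ker, show (![MvPolynomial.X 2, MvPolynomial.X 3, MvPolynomial.X 4, MvPolynomial.X 5] m : MvPolynomial (Fin 6) k) =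
    ι (MvPolynomial.X m) by rw [hι, MvPolynomial.eval₂Hom_X'], show Φ (ι (MvPolynomial.X m)) = (Φ.comp ι) (MvPolynomial.X m) from rfl, hΦι,
    RingHom.comp_apply] at hm
  have hinj₁ : Function.Injective (AdjoinRoot.of f₁) :=
    AdjoinRoot.of.injective_of_degree_ne_zero (by
      rw [Polynomial.degree_eq_natDegree (monic_f₁ _ H f₁ hf₁).1.ne_zero, (monic_f₁ _ H f₁ hf₁).2]; norm_num)
  have hmonic₂ : f₂.Monic ∧ f₂.natDegree = 2 := by rw [hf₂]; exact ⟨Polynomial.monic_X_pow_sub_C _ two_ne_zero, Polynomial.natDegree_X_pow_sub_C⟩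
  have hinj₂ : Function.Injective (AdjoinRoot.of f₂) :=
    AdjoinRoot.of.injective_of_degree_ne_zero (by rw [Polynomial.degree_eq_natDegree hmonic₂.1.ne_zero, hmonic₂.2]; norm_num)
  have h0 : AdjoinRoot.of f₁ (MvPolynomial.X m) = 0 := hinj₂ (by rw [hm, map_zero])
  exact MvPolynomial.X_ne_zero m (hinj₁ (by rw [h0, map_zero]))

end Summit.ResolutionOfSingularities.ResolutionOfSingularities.Theorems.FInjectiveMacaulayfication.MonicTowerPrime

end
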